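import Summits.BirchSwinnertonDyer.BirchSwinnertonDyer.Theorems.PrintCFramBottomClassIndexLawFiveLeEisensteinEndStateV19Currencies
import Summits.BirchSwinnertonDyer.BirchSwinnertonDyer.Theorems.PrintCFramBottomClassIndexLawFiveLeLevelDictionaryStrictSelmerSha
import Summits.BirchSwinnertonDyer.BirchSwinnertonDyer.Theorems.RamifiedSevenEllipticUnitsFrameDataOfGZK
import Summits.BirchSwinnertonDyer.BirchSwinnertonDyer.Theorems.PrintCFramBottomClassIndexLawFiveLeEisensteinEndStateV19
import Summits.BirchSwinnertonDyer.BirchSwinnertonDyer.Theorems.PrintCFramBottomClassIndexLawFiveLeLevelDictionaryBetaPartner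
import Summits.BirchSwinnertonDyer.Rank1Residual.Additive.QuadraticTwistBSDComparisonIsogeny
import Literature.NumberTheory.LFunctions.GeneralizedBernoulliOneOddNonvanishingAnyField
import Literature.NumberTheory.EllipticCurves.ComplexMultiplicationLFunctionIsogenyHoldsProofs
import HarnessLib

/-!
# Crux `PrintCFram.BottomClassIndexLawFiveLe` (stmt-BirchSwinnertonDyer-20372), line `eisenstein-resource-bdp-line`, registry v19:
# B1 IN THE CRUX'S OWN BINDERS — B1 ⟺ «BSD_p for the rank-one members with a p-DIVISIBLE GENERATOR» ∧ «BSD_p for the rank-one members with Ш[p] ≠ 0»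
# (⟹ Kriz–Li-free and Mazur–Wiles-free by the (α)/(α′) halves of the level dictionary; ⟸ by the (β) half modulo Mazur–Wiles Thm 2 and Cassels),
# and END STATE v19 restated with NO character and NO Bernoulli number in the research hypotheses

Cell `bsd-print-cfram`, seat `bsd-line-cfram-p1` LEAD g11, `--supports stmt-BirchSwinnertonDyer-20372` (helper). THEOREMS ONLY; no
definition, no named fact, no `sorry`. BSD is not proved by any of this; no summit statement is proved by this seat; the crux stays OPEN.

THE READING BEING BUILT (LEAD g11 integration target, STATUS 22:5xZ): with
* **B1-level** := «∀ class member `W` (CM, `p ≥ 5` CM-ramified, `r_an = 1`), generator `P` of `W(ℚ)/tors` with `∃ Q : W(ℚ_p), p • Q = P` ⟹ `BSDp W p`»,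
* **B1-sha** := «∀ class member `W` with `r_an = 1` and `∃ s ∈ Ш(W/ℚ), s ≠ 0 ∧ p • s = 0` ⟹ `BSDp W p`»,
registry v19's B1 `stub_bsdp_of_classFactor` (Bernoulli premise `‖B_{1,ψ⁻¹}‖_p ≤ p⁻¹`) satisfies **B1 ⟹ B1-level** (the (α) half of the level
dictionary, w6 g3 `LevelDictionaryAlpha.norm_bernoulliOnePrim_le_of_level_pos_of_generator`; `EisensteinEndStateV19Currencies.bsdp_of_level_pos_of_stubB1`,
p674634) and — THIS FILE — **B1 ⟹ B1-sha** (the (α′) half: on the UNIT class factor a member with a non-`p`-divisible rational point has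
`Ш(W/ℚ)[p] = 0`, w6 g3 `LevelDictionaryAlpha.sha_torsion_eq_zero_of_unit_classFactor`, p675821; contrapositive). The converse B1 ⟸ B1-level ∧ B1-sha
(modulo Mazur–Wiles Thm 2, Ribet direction, and Cassels along the CM-ramified `p`-isogeny) is the (β) half with the transverse ⟹ partner transport (w5 g3 `LevelDictionaryBeta.sha_or_levelPos_or_partner_of_classFactor`, p675860) — §2 below. Both directions together say: **the
crux's arithmetic residue B1 is EXACTLY `BSD_p` on the rank-one members with an invisible generator (`p`-divisible in `W(ℚ_p)`) or a non-trivial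
`Ш[p]` on the aligned model** — a statement in the crux's own binders (level `n`, `Ш`), with no character and no Bernoulli number.

* `bsdp_of_sha_ne_zero_of_stubB1` — B1 ⟹ B1-sha with the crux's generator binders `(P, hPtor, hgen)`.
* `bsdp_of_sha_ne_zero_of_stubB1_of_GZK` — the same with the generator supplied by GZK + Mordell–Weil (`RamifiedSevenEllipticUnits.exists_generator_with_level`).
* `stubB1_of_stubB1Level_of_stubB1Sha` — **B1-level ∧ B1-sha ⟹ B1** (modulo Mazur–Wiles Thm 2, GZK, Cassels, modularity): w5 g3's (β) with partner transport
  `LevelDictionaryBeta.sha_or_levelPos_or_partner_of_classFactor` + w4 g9's `bernoulliOnePrim_inv_ne_zero_of_odd` + isogeny invariance of `BSD(E,p)`.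
* `stubB1_iff_stubB1Level_and_stubB1Sha` — **B1 ⟺ B1-level ∧ B1-sha**.
* `bottomClassIndexLawFiveLe_of_prints4_of_mazurWiles_of_krizLi_of_cover_of_level_of_sha` — **END STATE v19 IN THE CRUX'S OWN BINDERS**: crux ⟸
  prints4 ∧ MW Thm 2 ∧ Kriz–Li Thm 1.20 ∧ C ∧ B1-level ∧ B1-sha.

References: crux workfiles `Lines/eisenstein_resource_bdp_line.lean` (v19), `Lines/eisenstein-resource-bdp-line-lead-g11.md`; w6 g3 STATUS 22:56:50Z.
-/

set_option autoImplicit false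
-- summit-side namespace `Summit.BirchSwinnertonDyer.BirchSwinnertonDyer.…` (single-conjunct summit, D-0017 layout)
set_option linter.dupNamespace false

noncomputable section

open scoped Classical
open NumberField WeierstrassCurve DirichletCharacter Literature.NumberTheory.LFunctions
  Literature.NumberTheory.EllipticCurves Literature.NumberTheory.EllipticCurves.KrizLi2019
  Literature.NumberTheory.EllipticCurves.Rank1Residual

namespace Summit.BirchSwinnertonDyer.BirchSwinnertonDyer.Theorems.PrintCFram.EisensteinEndStateV19Binders

open Summit.BirchSwinnertonDyer.BirchSwinnertonDyer.Theorems.PrintCFram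
open Summit.BirchSwinnertonDyer.BirchSwinnertonDyer.Theorems

/-! ## §1 B1 ⟹ B1-sha -/

/-- **Granted B1 (registry v19 text, hypothesis `hB1`), every class member of analytic rank one with `Ш(W/ℚ)[p] ≠ 0` satisfies
`BSD_p`.** For `W/ℚ` globally minimal with CM, `p ≥ 5` CM-ramified, `r_an(W) = 1`, a generator `P` of `W(ℚ)` modulo torsion (crux binders
`hPtor`, `hgen`) and a non-zero `p`-torsion element of `Ш(W/ℚ)`: `BSDp W p`. Proof: take the class's odd Kriz–Li datum
(`KrizLiBinders.exists_krizLiBinders_of_cmRamified`); if its class factor were a unit, w6 g3's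
`LevelDictionaryAlpha.sha_torsion_eq_zero_of_unit_classFactor` (Kummer theory + the unramified dichotomy + the Herbrand/Stickelberger engines;
Kriz–Li-free, Mazur–Wiles-free, `L`-value-free) would kill every `p`-torsion class of `Ш(W/ℚ)`, the generator being non-`p`-divisible
(`forall_zsmul_ne_of_generator`); so the class factor is a non-unit and B1 applies. BSD is not proved by any of this.
[cite: SilvermanAEC2009, VIII.§2 and X.§4] [cite: KrizLi2019, Thm. 1.20 (p. 8)] -/
theorem bsdp_of_sha_ne_zero_of_stubB1
    (hB1 :
    ∀ (W : WeierstrassCurve ℚ) [W.IsElliptic] [W.IsGloballyMinimal] (p : ℕ) [Fact p.Prime],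
      W.HasCM → CMRamified W p → 5 ≤ p → W.analyticRank = 1 →
      ∀ (f : ℕ) [NeZero f] (ψ : DirichletCharacter ℚ_[p] f) (ω : DirichletCharacter ℚ_[p] p),
        ψ.Odd → IsTeichmullerCharacter ω →
        (∀ ℓ : ℕ, ℓ.Prime → ¬ (ℓ ∣ p * W.conductorNorm ℤ) →
          ‖((W.LFunction ℓ : ℤ) : ℚ_[p]) - (ψ (ℓ : ZMod f) + ψ⁻¹ (ℓ : ZMod f) * ω (ℓ : ZMod p))‖ < 1) →
        ‖bernoulliOnePrim ψ⁻¹‖ ≤ (p : ℝ)⁻¹ →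
        BSDp W p)
    (W : WeierstrassCurve ℚ) [W.IsElliptic] [W.IsGloballyMinimal] (p : ℕ) [Fact p.Prime]
    (hCM : W.HasCM) (hram : CMRamified W p) (h5 : 5 ≤ p) (hr : W.analyticRank = 1)
    (P : W.toAffine.Point) (hPtor : ¬ IsOfFinAddOrder P)
    (hgen : ∀ R : W.toAffine.Point, ∃ (k : ℤ) (T : W.toAffine.Point), IsOfFinAddOrder T ∧ R = k • P + T)
    (hsha : ∃ s ∈ W.sha, s ≠ 0 ∧ p • s = 0) :
    BSDp W p := by
  obtain ⟨f, hf, ψ, ω, -, hω, hss, -, -, hodd⟩ := KrizLiBinders.exists_krizLiBinders_of_cmRamified W hCM hram h5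
  haveI := hf
  refine hB1 W p hCM hram h5 hr f ψ ω hodd hω hss ?_
  by_contra hcls
  obtain ⟨s, hs, hs0, hps⟩ := hsha
  exact hs0 (LevelDictionaryAlpha.sha_torsion_eq_zero_of_unit_classFactor W p hCM hram h5 ψ ω hodd hω hss hcls P
    (LevelDictionaryAlpha.forall_zsmul_ne_of_generator p W P hPtor hgen) hs hps)

/-- **The same with the generator supplied**: granted B1 and GZK (`hGZK`, the crux's own antecedent — rank `=` analytic rank in analytic
rank `≤ 1`; Mordell–Weil is a tree theorem), every class member of analytic rank one with `Ш(W/ℚ)[p] ≠ 0` satisfies `BSD_p`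
(`RamifiedSevenEllipticUnits.exists_generator_with_level` produces the generator). BSD is not proved by any of this.
[cite: SilvermanAEC2009, Prop. VII.6.3 and Thm. VIII.6.7] -/
theorem bsdp_of_sha_ne_zero_of_stubB1_of_GZK (hGZK : rank_eq_analyticRank_of_analyticRank_le_one)
    (hB1 :
    ∀ (W : WeierstrassCurve ℚ) [W.IsElliptic] [W.IsGloballyMinimal] (p : ℕ) [Fact p.Prime],
      W.HasCM → CMRamified W p → 5 ≤ p → W.analyticRank = 1 →
      ∀ (f : ℕ) [NeZero f] (ψ : DirichletCharacter ℚ_[p] f) (ω : DirichletCharacter ℚ_[p] p),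
        ψ.Odd → IsTeichmullerCharacter ω →
        (∀ ℓ : ℕ, ℓ.Prime → ¬ (ℓ ∣ p * W.conductorNorm ℤ) →
          ‖((W.LFunction ℓ : ℤ) : ℚ_[p]) - (ψ (ℓ : ZMod f) + ψ⁻¹ (ℓ : ZMod f) * ω (ℓ : ZMod p))‖ < 1) →
        ‖bernoulliOnePrim ψ⁻¹‖ ≤ (p : ℝ)⁻¹ →
        BSDp W p)
    (W : WeierstrassCurve ℚ) [W.IsElliptic] [W.IsGloballyMinimal] (p : ℕ) [Fact p.Prime]
    (hCM : W.HasCM) (hram : CMRamified W p) (h5 : 5 ≤ p) (hr : W.analyticRank = 1)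
    (hsha : ∃ s ∈ W.sha, s ≠ 0 ∧ p • s = 0) :
    BSDp W p := by
  have hrank : W.mordellWeilRank = 1 := by rw [(hGZK W hr.le).1, hr]
  obtain ⟨P, n, hP, hgen, -, -⟩ := RamifiedSevenEllipticUnits.exists_generator_with_level W p hrank
  exact bsdp_of_sha_ne_zero_of_stubB1 hB1 W p hCM hram h5 hr P hP hgen hsha


/-! ## §2 B1 ⟸ B1-level ∧ B1-sha (the (β) half, modulo Mazur–Wiles Thm 2 and Cassels along the CM-ramified `p`-isogeny) -/

/-- **B1-level ∧ B1-sha ⟹ B1** (registry v19's `stub_bsdp_of_classFactor`, VERBATIM as conclusion), granted Mazur–Wiles Thm 2 (`hMW`, Ribet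
direction, a refereed print fact) and the classical named facts GZK (`hGZK` — the crux's own antecedent), Cassels (`hCassels`), modularity
(`hmod`). Proof: for an Eisenstein-irregular member `W` (non-unit class factor; `B_{1,ψ⁻¹} ≠ 0` by w4 g9's
`bernoulliOnePrim_inv_ne_zero_of_odd`) with generator `g` (GZK + Mordell–Weil), w5 g3's (β) theorem with partner transport
`LevelDictionaryBeta.sha_or_levelPos_or_partner_of_classFactor` gives: `Ш(W)[p] ≠ 0` (⟹ B1-sha), or `g` is `p`-divisible in `W(ℚ_p)` (⟹ B1-level),
or the same alternative for the CM-ramified `p`-isogenous partner `W₁` and EVERY generator of `W₁(ℚ)` — then `BSD_p(W₁)` by B1-sha/B1-level for `W₁`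
(analytic rank one like `W`, `analyticRank_eq_of_isIsogenous'`) and `BSD_p(W)` by isogeny invariance of Miller's `BSD(E,p)` in analytic rank ≤ 1
(`TwistComparison.bsdp_iff_bsdp_of_isIsogenous`, Cassels). BSD is not proved by any of this.
[cite: MazurWiles1984, Thm. 2 (p. 216)] [cite: Cassels1965ArithmeticVIII] [cite: Miller2011LMS, §1 and Def. 1.1] -/
theorem stubB1_of_stubB1Level_of_stubB1Sha (hMW : Literature.NumberTheory.NumberFields.MazurWiles1984.thm2_card_oddChiClassGroup_eq_bernoulli)
    (hGZK : rank_eq_analyticRank_of_analyticRank_le_one) (hCassels : bsdRHS_eq_of_isIsogenous)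
    (hmod : hasEntireLFunction_rat)
    (hLevel :
    ∀ (W : WeierstrassCurve ℚ) [W.IsElliptic] [W.IsGloballyMinimal] (p : ℕ) [Fact p.Prime],
      W.HasCM → CMRamified W p → 5 ≤ p → W.analyticRank = 1 →
      ∀ P : W.toAffine.Point, ¬ IsOfFinAddOrder P →
        (∀ R : W.toAffine.Point, ∃ (k : ℤ) (T : W.toAffine.Point), IsOfFinAddOrder T ∧ R = k • P + T) →
        (∃ Q : (W.baseChange ℚ_[p]).toAffine.Point, p • Q = W.toPadicPoint p P) →
        BSDp W p)
    (hSha :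
    ∀ (W : WeierstrassCurve ℚ) [W.IsElliptic] [W.IsGloballyMinimal] (p : ℕ) [Fact p.Prime],
      W.HasCM → CMRamified W p → 5 ≤ p → W.analyticRank = 1 →
      (∃ s ∈ W.sha, s ≠ 0 ∧ p • s = 0) → BSDp W p) :
    ∀ (W : WeierstrassCurve ℚ) [W.IsElliptic] [W.IsGloballyMinimal] (p : ℕ) [Fact p.Prime],
      W.HasCM → CMRamified W p → 5 ≤ p → W.analyticRank = 1 →
      ∀ (f : ℕ) [NeZero f] (ψ : DirichletCharacter ℚ_[p] f) (ω : DirichletCharacter ℚ_[p] p),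
        ψ.Odd → IsTeichmullerCharacter ω →
        (∀ ℓ : ℕ, ℓ.Prime → ¬ (ℓ ∣ p * W.conductorNorm ℤ) →
          ‖((W.LFunction ℓ : ℤ) : ℚ_[p]) - (ψ (ℓ : ZMod f) + ψ⁻¹ (ℓ : ZMod f) * ω (ℓ : ZMod p))‖ < 1) →
        ‖bernoulliOnePrim ψ⁻¹‖ ≤ (p : ℝ)⁻¹ →
        BSDp W p := by
  intro W _ _ p _ hCM hram h5 hr f _ ψ ω hodd hω hss hcls
  have hB0 := Literature.NumberTheory.LFunctions.bernoulliOnePrim_inv_ne_zero_of_odd ψ hodd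
  have hrank : W.mordellWeilRank = 1 := by rw [(hGZK W hr.le).1, hr]
  obtain ⟨g, n, hgtor, hgen, -, -⟩ := RamifiedSevenEllipticUnits.exists_generator_with_level W p hrank
  rcases LevelDictionaryBeta.sha_or_levelPos_or_partner_of_classFactor W hMW hCM hram h5 ψ ω hodd hω hss hB0 hcls hgen with
    (hsha | hlev) | ⟨W₁, i₁, i₁', hCM₁, hram₁, ⟨φ, -⟩, hW₁⟩
  · exact hSha W p hCM hram h5 hr hsha
  · exact hLevel W p hCM hram h5 hr g hgtor hgen hlev
  · have hiso : IsIsogenous W W₁ := ⟨φ⟩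
    have hr₁ : W₁.analyticRank = 1 := by rw [← analyticRank_eq_of_isIsogenous' hiso]; exact hr
    have hrank₁ : W₁.mordellWeilRank = 1 := by rw [(hGZK W₁ hr₁.le).1, hr₁]
    obtain ⟨g₁, n₁, hg₁tor, hgen₁, -, -⟩ := RamifiedSevenEllipticUnits.exists_generator_with_level W₁ p hrank₁
    have hB₁ : BSDp W₁ p := by
      rcases hW₁ g₁ hgen₁ with hsha₁ | hlev₁
      · exact hSha W₁ p hCM₁ hram₁ h5 hr₁ hsha₁
      · exact hLevel W₁ p hCM₁ hram₁ h5 hr₁ g₁ hg₁tor hgen₁ hlev₁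
    exact (Rank1Residual.Additive.TwistComparison.bsdp_iff_bsdp_of_isIsogenous W W₁ p hCassels hGZK hmod hiso hr.le).mpr hB₁

/-- **B1 ⟺ B1-level ∧ B1-sha** (granted Mazur–Wiles Thm 2, GZK, Cassels, modularity): the crux's arithmetic residue on this line is EXACTLY
`BSD_p` on the rank-one class members with an invisible generator or a non-trivial `Ш[p]`. (⟹) `EisensteinEndStateV19Currencies.bsdp_of_level_pos_of_stubB1`
(w6 g3's (α)) and `bsdp_of_sha_ne_zero_of_stubB1_of_GZK` (w6 g3's (α′)); (⟸) `stubB1_of_stubB1Level_of_stubB1Sha` (w5 g3's (β) + partner).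
BSD is not proved by any of this. [cite: MazurWiles1984, Thm. 2 (p. 216)] [cite: Cassels1965ArithmeticVIII] -/
theorem stubB1_iff_stubB1Level_and_stubB1Sha (hMW : Literature.NumberTheory.NumberFields.MazurWiles1984.thm2_card_oddChiClassGroup_eq_bernoulli)
    (hGZK : rank_eq_analyticRank_of_analyticRank_le_one) (hCassels : bsdRHS_eq_of_isIsogenous)
    (hmod : hasEntireLFunction_rat) :
    (∀ (W : WeierstrassCurve ℚ) [W.IsElliptic] [W.IsGloballyMinimal] (p : ℕ) [Fact p.Prime],
      W.HasCM → CMRamified W p → 5 ≤ p → W.analyticRank = 1 →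
      ∀ (f : ℕ) [NeZero f] (ψ : DirichletCharacter ℚ_[p] f) (ω : DirichletCharacter ℚ_[p] p),
        ψ.Odd → IsTeichmullerCharacter ω →
        (∀ ℓ : ℕ, ℓ.Prime → ¬ (ℓ ∣ p * W.conductorNorm ℤ) →
          ‖((W.LFunction ℓ : ℤ) : ℚ_[p]) - (ψ (ℓ : ZMod f) + ψ⁻¹ (ℓ : ZMod f) * ω (ℓ : ZMod p))‖ < 1) →
        ‖bernoulliOnePrim ψ⁻¹‖ ≤ (p : ℝ)⁻¹ →
        BSDp W p) ↔
    ((∀ (W : WeierstrassCurve ℚ) [W.IsElliptic] [W.IsGloballyMinimal] (p : ℕ) [Fact p.Prime],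
      W.HasCM → CMRamified W p → 5 ≤ p → W.analyticRank = 1 →
      ∀ P : W.toAffine.Point, ¬ IsOfFinAddOrder P →
        (∀ R : W.toAffine.Point, ∃ (k : ℤ) (T : W.toAffine.Point), IsOfFinAddOrder T ∧ R = k • P + T) →
        (∃ Q : (W.baseChange ℚ_[p]).toAffine.Point, p • Q = W.toPadicPoint p P) →
        BSDp W p) ∧
    (∀ (W : WeierstrassCurve ℚ) [W.IsElliptic] [W.IsGloballyMinimal] (p : ℕ) [Fact p.Prime],
      W.HasCM → CMRamified W p → 5 ≤ p → W.analyticRank = 1 →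
      (∃ s ∈ W.sha, s ≠ 0 ∧ p • s = 0) → BSDp W p)) := by
  constructor
  · intro hB1
    exact ⟨fun W _ _ p _ hCM hram h5 hr P hPtor hgen hlev ↦
        EisensteinEndStateV19Currencies.bsdp_of_level_pos_of_stubB1 hB1 W p hCM hram h5 hr P hPtor hgen hlev,
      fun W _ _ p _ hCM hram h5 hr hsha ↦ bsdp_of_sha_ne_zero_of_stubB1_of_GZK hGZK hB1 W p hCM hram h5 hr hsha⟩
  · rintro ⟨hLevel, hSha⟩
    exact stubB1_of_stubB1Level_of_stubB1Sha hMW hGZK hCassels hmod hLevel hSha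

/-! ## §3 END STATE v19 in the crux's own binders -/

/-- **END STATE v19 IN THE CRUX'S OWN BINDERS.** The crux `BottomClassIndexLawFiveLe` follows from: (1) `hprints4` — the FOUR print facts of
`stub_prints` (Hsieh 2014 Thm. A; Liu–Zhang–Zhang 2018; `ToricPublishedInputs` — which carries GZK, modularity, Cassels; Burungale–Flach 2024 Cor. 2);
(2) `hMW` — Mazur–Wiles 1984 Thm. 2 (a FIFTH refereed print fact, used only through the (β) half of the level dictionary); (3) `hKL` — Kriz–Li 2019
Thm. 1.20; (4) `hC` — registry v19's Stub C (an admissible Heegner field with unit field factor exists; GL(1)/ℚ); and the TWO research statements in the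
crux's own binders: (5) **B1-level** — `BSD_p` for every rank-one class member whose generator is `p`-divisible in `W(ℚ_p)` (the crux's level binder
`n ≥ 1`); (6) **B1-sha** — `BSD_p` for every rank-one class member with `Ш(W/ℚ)[p] ≠ 0`. No Dirichlet character, no Bernoulli number in (5)–(6).
Proof: `stubB1_of_stubB1Level_of_stubB1Sha` gives B1, then END STATE v19 (`EisensteinEndStateV19.bottomClassIndexLawFiveLe_of_prints4_of_krizLi_of_classFactor_of_cover`,
p673416). CONDITIONAL on (1)–(6); BSD is not proved by any of this; the crux stays OPEN.
[cite: KrizLi2019, Thm. 1.20 (pp. 7–8), §8 (pp. 49–52)] [cite: MazurWiles1984, Thm. 2 (p. 216)] [cite: BurungaleKobayashiNakamuraOta2026, §1.4 (arXiv:2608.06879 p. 8)] -/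
theorem bottomClassIndexLawFiveLe_of_prints4_of_mazurWiles_of_krizLi_of_cover_of_level_of_sha
    (hprints4 :
    Hsieh2014.thmA_exists_isHsiehLFunction_unrPeriod_anyLevel ∧
    LiuZhangZhang2018.thm151_thm153_modularCurve_heegnerVector_additive ∧
    Summit.BirchSwinnertonDyer.BirchSwinnertonDyer.Theses.UniversalToricDescent.ToricPublishedInputs ∧
    bsdTriple_of_hasCM_of_L_one_ne_zero)
    (hMW : Literature.NumberTheory.NumberFields.MazurWiles1984.thm2_card_oddChiClassGroup_eq_bernoulli)
    (hKL : thm120_padicLogHeegner_unit_of_bernoulli)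
    (hC :
    ∀ (W : WeierstrassCurve ℚ) [W.IsElliptic] [W.IsGloballyMinimal] (p : ℕ) [Fact p.Prime],
      W.HasCM → CMRamified W p → 5 ≤ p → W.analyticRank = 1 →
      ∀ (f : ℕ) [NeZero f] (ψ : DirichletCharacter ℚ_[p] f) (ω : DirichletCharacter ℚ_[p] p),
        ψ.Odd → IsTeichmullerCharacter ω →
        (∀ ℓ : ℕ, ℓ.Prime → ¬ (ℓ ∣ p * W.conductorNorm ℤ) →
          ‖((W.LFunction ℓ : ℤ) : ℚ_[p]) - (ψ (ℓ : ZMod f) + ψ⁻¹ (ℓ : ZMod f) * ω (ℓ : ZMod p))‖ < 1) →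
        ¬ ‖bernoulliOnePrim ψ⁻¹‖ ≤ (p : ℝ)⁻¹ →
        ∃ (K : Type) (_ : Field K) (_ : NumberField K) (εK : DirichletCharacter ℚ_[p] (NumberField.discr K).natAbs),
          IsImaginaryQuadratic K ∧ SatisfiesHeegnerHypothesis (W.conductorNorm ℤ) K ∧ Odd (NumberField.discr K) ∧
          NumberField.discr K < -4 ∧ IsKroneckerCharacterOf K εK ∧
          ¬ ‖bernoulliOnePrim (bernoulliCharTwo ψ εK ω)‖ ≤ (p : ℝ)⁻¹)
    (hLevel :
    ∀ (W : WeierstrassCurve ℚ) [W.IsElliptic] [W.IsGloballyMinimal] (p : ℕ) [Fact p.Prime],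
      W.HasCM → CMRamified W p → 5 ≤ p → W.analyticRank = 1 →
      ∀ P : W.toAffine.Point, ¬ IsOfFinAddOrder P →
        (∀ R : W.toAffine.Point, ∃ (k : ℤ) (T : W.toAffine.Point), IsOfFinAddOrder T ∧ R = k • P + T) →
        (∃ Q : (W.baseChange ℚ_[p]).toAffine.Point, p • Q = W.toPadicPoint p P) →
        BSDp W p)
    (hSha :
    ∀ (W : WeierstrassCurve ℚ) [W.IsElliptic] [W.IsGloballyMinimal] (p : ℕ) [Fact p.Prime],
      W.HasCM → CMRamified W p → 5 ≤ p → W.analyticRank = 1 →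
      (∃ s ∈ W.sha, s ≠ 0 ∧ p • s = 0) → BSDp W p) :
    Summit.BirchSwinnertonDyer.BirchSwinnertonDyer.Theses.PrintCFram.BottomClassIndexLawFiveLe := by
  obtain ⟨-, -, ⟨-, -, hGZK, -⟩, -, -, hmod, hCassels⟩ := Theorems.PrintCFram.InputsPrints.prints7_of_prints4 hprints4
  exact EisensteinEndStateV19.bottomClassIndexLawFiveLe_of_prints4_of_krizLi_of_classFactor_of_cover hprints4 hKL
    (stubB1_of_stubB1Level_of_stubB1Sha hMW hGZK hCassels hmod hLevel hSha) hC

end Summit.BirchSwinnertonDyer.BirchSwinnertonDyer.Theorems.PrintCFram.EisensteinEndStateV19Binders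

end
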